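import Summits.HodgeConjecture.HodgeConjecture.Theorems.VHCAbelianSchemesRoadIsogenyDerivedAdjointPairDefs
import Literature.AlgebraicGeometry.Modules.PushforwardAffineExact
import Literature.AlgebraicGeometry.Motives.AbelianVarietyIsogenyPullbackExact
import HarnessLib

/-!
# Road №4 (`VHCAbelianSchemesRoad`) — input (At) of core (SC) REDUCED to the twisted-jet comparison of (L7b) and ONE law
# of the node «`IsogenyDerivedAdjointPair`» (crux stmt-HodgeConjecture-26512, (c1) THEOREM T′)

research route conditional on HC_CM; not a corollary; Q11.4-sentence-2 already refuted in dim ≥ 3.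

Seat core-w3 (director-hodge g16 R16.11 (3) «core-w3 = (Q1a) THEN (At) `AtiyahClassPushforwardCompat` in the model (NODE, α)»; k0
HOME INBOX «core-w3 (At) k0»). `--supports stmt-HodgeConjecture-26512 --as helper`; closes NO stub or item; nothing here says (At),
(L7b), the node, (Adj), (SC), (c1), THEOREM T′, 26511 ∕ 26512 ∕ 23176, `HC_AV`, `HC_CM` or HC holds; HC_CM HELD, by name only;
typed ≠ proved.

THE INPUT. (At)Pair `AtiyahClassPushforwardCompatPair P α` (core-w4, `…IsogenyDerivedAdjointPairDefs`): for every isogeny `g` of a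
complex abelian variety `A`, bounded complex of vector bundles `E•`, `q` and `x ∈ Ext²(E•, E•)`,
`g_{**}(x · ι• · At(E•)^q) · [Q α_q] = g_{**}(x) · ι• · At(g_*•E•)^q`, where `g_{**} = (P A g hg).mapShiftedHom` is the action of the
node and `α` the twist data (L7b). In degree one (an isomorphism `e` of schemes, `e_{**} = D(e_*)`) this is the venture's (N4)
`Summit.Ventures.HSemireg.mapShiftedHom_extMulAtiyahPower_comp`, proved from: the iso of the termwise twisted Atiyah sequences
`e_*•(0 → K⊗Ωʲ⁺¹ → Pʲ(K) → K⊗Ωʲ → 0) ≅ (same for e_*•K)`, `e_{**}(δ) = δ(e_*•–)` (Mathlib `map_triangleOfSESδ`), naturality of `δ`,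
induction on `q`, and `e_*•(ι•) ≫ α_0 = ι•`.

WHAT IS PROVED HERE (sorry-free): the SAME derivation for an isogeny of ANY degree over the functor-free node, with every input that is
not a theorem DISPLAYED BY NAME —
* §1 the ONE EXTRA NODE LAW the derivation needs — naturality of `adj` in its first variable along CONNECTING MORPHISMS `triangleOfSESδ`
  of termwise short exact sequences of bounded vector-bundle complexes (the node's `adj_mk₀_comp` covers chain maps only) — is consumed
  BY NAME as core-w4's `IsogenyDerivedAdjointPair.AdjTriangleOfSESδComp` (a displayed hypothesis `hδ`; in a functor model «`Rg_*` is
  triangulated», in route K the mapping-cone description of `δ`).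
* §2 THEOREMS (no display): the termwise twisted Atiyah sequence `T_j(K)` of a bounded vector-bundle complex stays SHORT EXACT under
  `g_*•` (isogenies are affine: `Modules/PushforwardAffineExact`, core-w1; the kernel term is a vector bundle, hence affine-localizing)
  and then under `g^*•` (isogenies are flat, flat pull-back is exact: `Modules/PullbackStalk` ∕ `Motives/AbelianVarietyIsogenyPullbackExact`,
  core-qc).
* §3 `TwistJetPushforwardComparison α`, `IotaPushforwardCompat α` — the MODULE-LEVEL content of (L7b) that (At) consumes beyond the
  bare isomorphisms `α_q`: a morphism of short complexes `g_*•T_j(K) ⟶ T_j(g_*•K)` with outer components `α_{j+1}`, `α_j` (the twisted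
  JET comparison `g_*•Pʲ(K) → Pʲ(g_*•K)`), and `g_*•(ι•_K) ≫ α_0 = ι•_{g_*•K}`. IN-HOUSE predicates on the data `α`; hypotheses.
* §4 over ONE pair `P : IsogenyDerivedAdjointPair A g` satisfying the law: **`mapShiftedHom_complexAtiyahStep_pair`** —
  `g_{**}(At_j(K)) = δ(g_*•T_j(K))` (from `triangleOfSESδ_naturality` along the counit `ε• : g^*•g_*•T_j(K) → T_j(K)` and the law,
  the transposed counit class being the identity), then `…_comp`, **`mapShiftedHom_complexAtiyahPower_pair_comp`** (induction on `q`,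
  `mapShiftedHom_comp`), `…PowerFrom…`, **`mapShiftedHom_extMulAtiyahPower_pair_comp`**.
* §5 **`atiyahClassPushforwardCompatPair_of : (∀ A g hg, (P A g hg).AdjTriangleOfSESδComp) → (∀ A g hg, TwistJetPushforwardComparison
  (α A g hg)) → (∀ A g hg, IotaPushforwardCompat (α A g hg)) → AtiyahClassPushforwardCompatPair P α`** — (At) is a kernel theorem MODULO exactly the
  node law and the module-level jet ∕ `ι` compatibilities of (L7b).

References: [cite: BuchweitzFlenner2003, §3 (Atiyah class of a complex) and Def. 4.1] [cite: Atiyah1957, §4 Prop. 6–7]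
[cite: Weibel1994, §10.4, Example 10.4.9 and §10.5] [cite: Hartshorne1977, II §5 p. 110 (f^* ⊣ f_*), III Prop. 8.1]
[cite: StacksProject, Tag 01XC and Tag 02N2] [cite: MumfordAV1970, §7 Thm. 4 (p. 72)].
-/

noncomputable section

-- `TopCat.Presheaf`/`Scheme.Modules` are not reducible (as in Mathlib's `AlgebraicGeometry/Modules/Sheaf.lean`).
set_option backward.isDefEq.respectTransparency false

open CategoryTheory CategoryTheory.Category CategoryTheory.Limits AlgebraicGeometry Opposite
open DerivedCategory

namespace Summit.HodgeConjecture.HodgeConjecture.Ring2.SemiregularRepresentatives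

set_option linter.dupNamespace false -- the cell's namespace repeats the summit name, as in every `Ring2*` file

open Literature.AlgebraicGeometry Literature.AlgebraicGeometry.Modules Literature.AlgebraicGeometry.Motives
open Literature.AlgebraicGeometry.Motives.AbelianVariety Literature.AlgebraicGeometry.KTheory
open Summit.Ventures.HSemireg

universe w

/-! ## §1 The node law consumed: `IsogenyDerivedAdjointPair.AdjTriangleOfSESδComp` (core-w4, `…IsogenyDerivedAdjointPairDefs` §5)

The ONE extra law of the node that the derivation needs — naturality of the hom-equivalence `adj` in its first variable along CONNECTING
MORPHISMS `DerivedCategory.triangleOfSESδ` of termwise short exact sequences of bounded vector-bundle complexes (the node's `adj_mk₀_comp`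
covers chain maps only) — is the tree's `P.AdjTriangleOfSESδComp` (typed by core-w4 to this seat's k0 signature); it is the hypothesis
`hδ` below, displayed, never asserted. In a functor model it is «`Rg_*` is triangulated»; in the Hom-level K-injective model (route K)
it follows from the mapping-cone description of `δ`. -/

/-! ## §2 The termwise twisted Atiyah sequences stay short exact under `g_*•` and `g^*•g_*•` (THEOREMS) -/

section Exactness

variable (A : AbelianVariety ℂ) (g : A ⟶ A)

/-- The terms `K ⊗ Ωʲ` of a bounded vector-bundle complex twisted by a Hodge sheaf are affine-localizing (vector bundles are
quasi-coherent, quasi-coherent modules are affine-localizing). [folklore] -/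
private theorem isAffineLocalizing_twistHodgeComplex_X {K : CochainComplex A.X.left.Modules ℤ} (hK : IsBoundedVBComplex K)
    (j : ℕ) (i : ℤ) : IsAffineLocalizing ((twistHodgeComplex A.X j K).X i) := by
  haveI := ((isBoundedVBComplex_twistHodgeComplex A hK j).isFiniteLocallyFree i).isVectorBundle.1
  exact IsAffineLocalizing.of_isQuasicoherent _

/-- **`g_*•T_j(K)` is short exact** for an isogeny `g` and a bounded vector-bundle complex `K`: degreewise, the twisted Atiyah
sequence `0 → Kⁱ⊗Ωʲ⁺¹ → Pʲ(Kⁱ) → Kⁱ⊗Ωʲ → 0` has affine-localizing kernel and `g` is affine, so `g_*` keeps it short exact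
(`shortExact_map_pushforward_of_isAffineHom`, Stacks 01XC). [cite: StacksProject, Tag 01XC] -/
theorem shortExact_twistJet_map_pushforward (hg : IsIsogeny g) {K : CochainComplex A.X.left.Modules ℤ}
    (hK : IsBoundedVBComplex K) (j : ℕ) :
    ((twistJetComplexShortComplex A.X j K).map
      ((Scheme.Modules.pushforward (Hom.toSchemeHom g)).mapHomologicalComplex (ComplexShape.up ℤ))).ShortExact := by
  haveI := hg.2
  refine HomologicalComplex.shortExact_of_degreewise_shortExact _ fun i => ?_
  exact shortExact_map_pushforward_of_isAffineHom (Hom.toSchemeHom g)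
    (Literature.AlgebraicGeometry.HodgeTheory.twistJetShortComplex_shortExact (K.X i) j)
    (isAffineLocalizing_twistHodgeComplex_X A hK (j + 1) i)

/-- **`g^*•g_*•T_j(K)` is short exact** for an isogeny `g` and a bounded vector-bundle complex `K`: `g` is flat, and flat pull-back
is exact on ALL `𝒪`-modules (`IsIsogeny.shortExact_map_pullback`, core-qc's `Modules/PullbackStalk`: the stalk formula; Stacks 02N2),
applied to the short exact `g_*•T_j(K)`. [cite: StacksProject, Tag 02N2] [cite: GortzWedhorn2023, Prop. 27.54] -/
theorem shortExact_twistJet_map_pushforward_pullback (hg : IsIsogeny g) {K : CochainComplex A.X.left.Modules ℤ}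
    (hK : IsBoundedVBComplex K) (j : ℕ) :
    (((twistJetComplexShortComplex A.X j K).map
      ((Scheme.Modules.pushforward (Hom.toSchemeHom g)).mapHomologicalComplex (ComplexShape.up ℤ))).map
      ((Scheme.Modules.pullback (Hom.toSchemeHom g)).mapHomologicalComplex (ComplexShape.up ℤ))).ShortExact := by
  refine HomologicalComplex.shortExact_of_degreewise_shortExact _ fun i => ?_
  exact hg.shortExact_map_pullback _
    ((HomologicalComplex.shortExact_iff_degreewise_shortExact _).mp (shortExact_twistJet_map_pushforward A g hg hK j) i)

end Exactness

/-! ## §3 The module-level content of (L7b) consumed by (At): the twisted-jet comparison and `ι•` (displayed predicates on `α`) -/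

section TwistData

variable {A : AbelianVariety ℂ} {g : A ⟶ A} (α : IsogenyTwistPushforwardIso A g)

/-- **The twisted-JET comparison (`TwistJetPushforwardComparison α`)**: for every cochain complex `K` with finite locally free
terms and every `j` there is a MORPHISM of short complexes of cochain complexes
`g_*•(0 → K⊗Ωʲ⁺¹ → Pʲ(K) → K⊗Ωʲ → 0) ⟶ (0 → g_*•K⊗Ωʲ⁺¹ → Pʲ(g_*•K) → g_*•K⊗Ωʲ → 0)` whose outer components are the twist
isomorphisms `α_{j+1}`, `α_j` — i.e. a jet comparison `g_*•Pʲ(K) → Pʲ(g_*•K)` compatible with `ι`, `π` (model: componentwise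
`(φ, ψ) ↦ (α_j φ, α_{j+1} ψ)` on twisted-jet sections, linear for the twisted module structures because `α_{j+1}(d(g♯b) ∧ φ) =
db ∧ α_j(φ)`; degree one: the venture's `twistJetComplexShortComplexPushforwardHom`). The module-level part of (L7b) beyond the bare
isomorphisms. IN-HOUSE predicate on the data `α`; NOT PROVED for an isogeny of degree `≥ 2`; a HYPOTHESIS wherever used.
[cite: Atiyah1957, §4 Prop. 6–7 (functoriality of jets)] [cite: BuchweitzFlenner2003, §3 (Atiyah class of a complex)] -/
@[conjecture] def TwistJetPushforwardComparison : Prop :=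
  ∀ (K : CochainComplex A.X.left.Modules ℤ) (hK : ∀ i, IsFiniteLocallyFree (K.X i)) (j : ℕ),
    ∃ φ : (twistJetComplexShortComplex A.X j K).map
        ((Scheme.Modules.pushforward (Hom.toSchemeHom g)).mapHomologicalComplex (ComplexShape.up ℤ)) ⟶
        twistJetComplexShortComplex A.X j (endoPushforwardComplex A g K),
      φ.τ₁ = (α (j + 1) K hK).hom ∧ φ.τ₃ = (α j K hK).hom

/-- **`ι•` along `g_*•` (`IotaPushforwardCompat α`)**: `g_*•(ι•_K) ≫ α_0 = ι•_{g_*•K}` for every complex `K` with finite locally free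
terms (`ι• : K → K ⊗ Ω⁰` = biduality then `𝒪 ≅ Ω⁰`, termwise; degree one: the venture's `map_toTwistHodgeZeroC_comp`) — a
normalisation of `α_0`. IN-HOUSE predicate on `α`; NOT PROVED for `deg g ≥ 2`; a HYPOTHESIS wherever used.
[cite: Hartshorne1977, II Ex. 5.1 (a), (b)] [cite: BuchweitzFlenner2003, Def. 4.1] -/
@[conjecture] def IotaPushforwardCompat : Prop :=
  ∀ (K : CochainComplex A.X.left.Modules ℤ) (hK : ∀ i, IsFiniteLocallyFree (K.X i)),
    ((Scheme.Modules.pushforward (Hom.toSchemeHom g)).mapHomologicalComplex (ComplexShape.up ℤ)).map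
        (toTwistHodgeZeroC A.X K) ≫ (α 0 K hK).hom =
      toTwistHodgeZeroC A.X (endoPushforwardComplex A g K)

end TwistData

/-! ## §4 Over ONE pair satisfying the law: `g_{**}` and the Atiyah steps, powers, and the argument of `σ_q` -/

section OnePair

variable {A : AbelianVariety ℂ} {g : A ⟶ A} (hg : IsIsogeny g) [HasDerivedCategory.{w} A.X.left.Modules]
  (P : IsogenyDerivedAdjointPair A g) (hP : P.AdjTriangleOfSESδComp)

/-- The counit `ε•` on the three complexes of `T_j(K)` is a morphism of short complexes `g^*•g_*•T_j(K) ⟶ T_j(K)`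
(termwise naturality of Mathlib's counit). [cite: Hartshorne1977, II §5 p. 110 (f^* ⊣ f_*)] -/
private def counitShortComplexHom (S : ShortComplex (CochainComplex A.X.left.Modules ℤ)) :
    (S.map ((Scheme.Modules.pushforward (Hom.toSchemeHom g)).mapHomologicalComplex (ComplexShape.up ℤ))).map
        ((Scheme.Modules.pullback (Hom.toSchemeHom g)).mapHomologicalComplex (ComplexShape.up ℤ)) ⟶ S where
  τ₁ := counitComplex A g S.X₁
  τ₂ := counitComplex A g S.X₂
  τ₃ := counitComplex A g S.X₃
  comm₁₂ := (counitComplex_naturality A g S.f).symm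
  comm₂₃ := (counitComplex_naturality A g S.g).symm

include hg in
/-- `[Q ε•_{K⊗Ωʲ}] · At_j(K) = δ(g^*•g_*•T_j(K)) · [Q ε•_{K⊗Ωʲ⁺¹}]`: naturality of the connecting morphism (Mathlib
`DerivedCategory.triangleOfSESδ_naturality`) along the counit morphism of short exact sequences `ε• : g^*•g_*•T_j(K) ⟶ T_j(K)`.
[cite: Weibel1994, §10.4 and Example 10.4.9] -/
private theorem counitClass_comp_complexAtiyahStep {K : CochainComplex A.X.left.Modules ℤ} (hK : IsBoundedVBComplex K)
    (j : ℕ) :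
    (counitClass A g (twistHodgeComplex A.X j K)).comp (complexAtiyahStep A.X j K) (add_zero (1 : ℤ)) =
      ShiftedHom.comp (triangleOfSESδ (shortExact_twistJet_map_pushforward_pullback A g hg hK j) : ShiftedHom _ _ (1 : ℤ))
        (counitClass A g (twistHodgeComplex A.X (j + 1) K)) (zero_add (1 : ℤ)) := by
  rw [counitClass_def, counitClass_def, ShiftedHom.mk₀_comp, ShiftedHom.comp_mk₀, complexAtiyahStep]
  exact (triangleOfSESδ_naturality (shortExact_twistJet_map_pushforward_pullback A g hg hK j)
    (twistJetComplexShortComplex_shortExact (X := A.X) j K)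
    (counitShortComplexHom (g := g) (twistJetComplexShortComplex A.X j K))).symm

include hg in
/-- `δ(g_*•T_j(K)) · adj([Q ε•_{K⊗Ωʲ⁺¹}]) = δ(g_*•T_j(K))`: the transposed counit class is the identity class (the node's
normalisation `adj_counitClass`). [cite: Hartshorne1977, II §5 p. 110 (f^* ⊣ f_*)] -/
private theorem triangleOfSESδ_comp_adj_counitClass {K : CochainComplex A.X.left.Modules ℤ} (hK : IsBoundedVBComplex K)
    (j : ℕ) :
    ShiftedHom.comp (triangleOfSESδ (shortExact_twistJet_map_pushforward A g hg hK j) : ShiftedHom _ _ (1 : ℤ))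
        (P.adj (P.isBoundedVBComplex_pushforward (isBoundedVBComplex_twistHodgeComplex A hK (j + 1)))
          (isBoundedVBComplex_twistHodgeComplex A hK (j + 1)) 0 (counitClass A g (twistHodgeComplex A.X (j + 1) K)))
        (zero_add (1 : ℤ)) =
      triangleOfSESδ (shortExact_twistJet_map_pushforward A g hg hK j) := by
  rw [P.adj_counitClass]
  exact ShiftedHom.comp_mk₀_id _ _ _

include hg hP in
/-- **`g_{**}(At_j(K)) = δ(g_*•T_j(K))`**: the action of the pair on the `j`-th Atiyah step of a bounded vector-bundle complex `K`
is the connecting morphism of the (short exact, §2) direct image of its twisted Atiyah sequence. Proof: `g_{**}(δ) = adj([Q ε•] · δ)`;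
naturality of `δ` along the counit morphism `ε• : g^*•g_*•T_j(K) → T_j(K)` rewrites `[Q ε•_{X₃}] · δ(T) = δ(g^*•g_*•T) · [Q ε•_{X₁}]`;
the node law `AdjTriangleOfSESδComp` moves `δ` out of `adj`, and the transposed counit class is the identity (`adj_counitClass`). The
finite-étale twin of the venture's `mapShiftedHom_complexAtiyahStep`. [cite: Weibel1994, §10.4 and Example 10.4.9] [cite: BuchweitzFlenner2003, §3] -/
theorem mapShiftedHom_complexAtiyahStep_pair {K : CochainComplex A.X.left.Modules ℤ} (hK : IsBoundedVBComplex K) (j : ℕ) :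
    P.mapShiftedHom (isBoundedVBComplex_twistHodgeComplex A hK j) (isBoundedVBComplex_twistHodgeComplex A hK (j + 1))
        (complexAtiyahStep A.X j K) =
      triangleOfSESδ (shortExact_twistJet_map_pushforward A g hg hK j) := by
  rw [IsogenyDerivedAdjointPair.mapShiftedHom_def, counitClass_comp_complexAtiyahStep hg hK j]
  exact (hP (shortExact_twistJet_map_pushforward A g hg hK j) (shortExact_twistJet_map_pushforward_pullback A g hg hK j)
    (P.isBoundedVBComplex_pushforward (isBoundedVBComplex_twistHodgeComplex A hK (j + 1)))
    (P.isBoundedVBComplex_pushforward (isBoundedVBComplex_twistHodgeComplex A hK j))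
    (isBoundedVBComplex_twistHodgeComplex A hK (j + 1)) (zero_add (1 : ℤ))
    (counitClass A g (twistHodgeComplex A.X (j + 1) K))).trans
    (triangleOfSESδ_comp_adj_counitClass hg P hK j)

variable (α : IsogenyTwistPushforwardIso A g)

include hg hP in
/-- **`g_{**}(At_j(K)) · [Q α_{j+1}] = [Q α_j] · At_j(g_*•K)`** given the twisted-jet comparison (§3): naturality of the connecting
morphism along the morphism of twisted Atiyah sequences `g_*•T_j(K) ⟶ T_j(g_*•K)` with outer components `α_{j+1}`, `α_j`.
The finite-étale twin of the venture's `mapShiftedHom_complexAtiyahStep_comp`. [cite: BuchweitzFlenner2003, §3 (Atiyah class of a complex)] -/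
theorem mapShiftedHom_complexAtiyahStep_pair_comp (hα : TwistJetPushforwardComparison α)
    {K : CochainComplex A.X.left.Modules ℤ} (hK : IsBoundedVBComplex K) (j : ℕ) :
    (P.mapShiftedHom (isBoundedVBComplex_twistHodgeComplex A hK j) (isBoundedVBComplex_twistHodgeComplex A hK (j + 1))
        (complexAtiyahStep A.X j K)).comp
        (ShiftedHom.mk₀ (0 : ℤ) rfl (Q.map (α (j + 1) K hK.isFiniteLocallyFree).hom)) (zero_add 1) =
      (ShiftedHom.mk₀ (0 : ℤ) rfl (Q.map (α j K hK.isFiniteLocallyFree).hom)).comp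
        (complexAtiyahStep A.X j (endoPushforwardComplex A g K)) (add_zero 1) := by
  obtain ⟨φ, hφ₁, hφ₃⟩ := hα K hK.isFiniteLocallyFree j
  rw [mapShiftedHom_complexAtiyahStep_pair hg P hP hK j, ShiftedHom.comp_mk₀, ShiftedHom.mk₀_comp, complexAtiyahStep,
    ← hφ₁, ← hφ₃]
  exact triangleOfSESδ_naturality _ (twistJetComplexShortComplex_shortExact (X := A.X) j _) φ

include hg hP in
/-- **`g_{**}(At(K)^q) · [Q α_q] = [Q α_0] · At(g_*•K)^q`** (induction on `q`; `g_{**}` is multiplicative, `mapShiftedHom_comp`).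
The finite-étale twin of the venture's `mapShiftedHom_complexAtiyahPower_comp`. [cite: BuchweitzFlenner2003, Def. 4.1 (powers of the Atiyah class)] -/
theorem mapShiftedHom_complexAtiyahPower_pair_comp (hα : TwistJetPushforwardComparison α)
    {K : CochainComplex A.X.left.Modules ℤ} (hK : IsBoundedVBComplex K) (q : ℕ) :
    (P.mapShiftedHom (isBoundedVBComplex_twistHodgeComplex A hK 0) (isBoundedVBComplex_twistHodgeComplex A hK q)
        (complexAtiyahPower A.X K q)).comp
        (ShiftedHom.mk₀ (0 : ℤ) rfl (Q.map (α q K hK.isFiniteLocallyFree).hom)) (zero_add _) =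
      (ShiftedHom.mk₀ (0 : ℤ) rfl (Q.map (α 0 K hK.isFiniteLocallyFree).hom)).comp
        (complexAtiyahPower A.X (endoPushforwardComplex A g K) q) (add_zero _) := by
  induction q with
  | zero =>
    rw [complexAtiyahPower_zero, complexAtiyahPower_zero]
    erw [ShiftedHom.comp_mk₀_id]
    rw [← (Q (C := A.X.left.Modules)).map_id]
    erw [P.mapShiftedHom_mk₀]
    rw [CategoryTheory.Functor.map_id, CategoryTheory.Functor.map_id]
    erw [ShiftedHom.mk₀_id_comp]
  | succ q ih =>
    rw [complexAtiyahPower_succ, complexAtiyahPower_succ,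
      P.mapShiftedHom_comp (isBoundedVBComplex_twistHodgeComplex A hK 0) (isBoundedVBComplex_twistHodgeComplex A hK q)
        (isBoundedVBComplex_twistHodgeComplex A hK (q + 1)),
      shiftedHom_comp_comp_mk₀, mapShiftedHom_complexAtiyahStep_pair_comp hg P hP α hα hK q, ← shiftedHom_comp_mk₀_comp, ih,
      shiftedHom_mk₀_comp_comp]

include hg hP in
/-- **`g_{**}(ι• · At(K)^q) · [Q α_q] = ι• · At(g_*•K)^q`** given the twisted-jet comparison and the `ι•`-compatibility of `α_0` (§3).
The finite-étale twin of the venture's `mapShiftedHom_complexAtiyahPowerFrom_comp`. [cite: BuchweitzFlenner2003, Def. 4.1] -/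
theorem mapShiftedHom_complexAtiyahPowerFrom_pair_comp (hα : TwistJetPushforwardComparison α) (hι : IotaPushforwardCompat α)
    {K : CochainComplex A.X.left.Modules ℤ} (hK : IsBoundedVBComplex K) (q : ℕ) :
    (P.mapShiftedHom hK (isBoundedVBComplex_twistHodgeComplex A hK q) (complexAtiyahPowerFrom q K)).comp
        (ShiftedHom.mk₀ (0 : ℤ) rfl (Q.map (α q K hK.isFiniteLocallyFree).hom)) (zero_add _) =
      complexAtiyahPowerFrom q (endoPushforwardComplex A g K) := by
  rw [complexAtiyahPowerFrom, complexAtiyahPowerFrom,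
    P.mapShiftedHom_comp hK (isBoundedVBComplex_twistHodgeComplex A hK 0) (isBoundedVBComplex_twistHodgeComplex A hK q),
    P.mapShiftedHom_mk₀, shiftedHom_mk₀_comp_comp, mapShiftedHom_complexAtiyahPower_pair_comp hg P hP α hα hK q,
    ← shiftedHom_mk₀_comp_comp, ShiftedHom.mk₀_comp_mk₀, ← Functor.map_comp, hι K hK.isFiniteLocallyFree]

include hg hP in
/-- **The argument of `σ_q` along `g_{**}`, over one pair**: `g_{**}(x · ι• · At(K)^q) · [Q α_q] = g_{**}(x) · ι• · At(g_*•K)^q` for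
every `x ∈ Ext²(K, K)`, given the node law, the twisted-jet comparison and the `ι•`-compatibility. The finite-étale twin of the
venture's `mapShiftedHom_extMulAtiyahPower_comp`. [cite: BuchweitzFlenner2003, Def. 4.1] -/
theorem mapShiftedHom_extMulAtiyahPower_pair_comp (hα : TwistJetPushforwardComparison α) (hι : IotaPushforwardCompat α)
    {K : CochainComplex A.X.left.Modules ℤ} (hK : IsBoundedVBComplex K) (q : ℕ)
    (x : ShiftedHom (Q.obj K) (Q.obj K) (2 : ℤ)) :
    (P.mapShiftedHom hK (isBoundedVBComplex_twistHodgeComplex A hK q) (extMulAtiyahPower A.X K q x)).comp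
        (ShiftedHom.mk₀ (0 : ℤ) rfl (Q.map (α q K hK.isFiniteLocallyFree).hom)) (zero_add _) =
      extMulAtiyahPower A.X (endoPushforwardComplex A g K) q (P.mapShiftedHom hK hK x) := by
  rw [extMulAtiyahPower_eq_comp, extMulAtiyahPower_eq_comp,
    P.mapShiftedHom_comp hK hK (isBoundedVBComplex_twistHodgeComplex A hK q), shiftedHom_comp_comp_mk₀,
    mapShiftedHom_complexAtiyahPowerFrom_pair_comp hg P hP α hα hι hK q]

end OnePair

/-! ## §5 (At)Pair as a kernel theorem modulo the node law and the module-level jet ∕ `ι•` compatibilities of (L7b) -/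

section Assembly

variable
  (P : ∀ (A : AbelianVariety ℂ) (g : A ⟶ A), IsIsogeny g →
    letI := HasDerivedCategory.standard A.X.left.Modules
    IsogenyDerivedAdjointPair A g)
  (α : ∀ (A : AbelianVariety ℂ) (g : A ⟶ A), IsIsogeny g → IsogenyTwistPushforwardIso A g)

/-- **(At) REDUCED**: the displayed input (At)Pair `AtiyahClassPushforwardCompatPair P α` of core (SC) (crux stmt-HodgeConjecture-26512,
THEOREM T′) HOLDS as soon as (iv) every pair `P A g hg` satisfies the node law `AdjTriangleOfSESδComp` (core-w4; naturality of `adj`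
along connecting morphisms), (i-a) the twist data `α` extend to morphisms of the twisted Atiyah sequences (`TwistJetPushforwardComparison`, the jet
comparison `g_*•Pʲ(K) → Pʲ(g_*•K)`), and (i-b) `g_*•ι• ≫ α_0 = ι•` (`IotaPushforwardCompat`); the exactness inputs are THEOREMS (§2:
isogenies are affine and flat). CONDITIONAL on exactly these named inputs; closes no stub; HC_CM untouched.
[cite: BuchweitzFlenner2003, §3 and Def. 4.1] [cite: Atiyah1957, §4 Prop. 6–7] [cite: Weibel1994, §10.4 and Example 10.4.9] -/
theorem atiyahClassPushforwardCompatPair_of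
    (hδ : ∀ (A : AbelianVariety ℂ) (g : A ⟶ A) (hg : IsIsogeny g),
      letI := HasDerivedCategory.standard A.X.left.Modules
      (P A g hg).AdjTriangleOfSESδComp)
    (hjet : ∀ (A : AbelianVariety ℂ) (g : A ⟶ A) (hg : IsIsogeny g), TwistJetPushforwardComparison (α A g hg))
    (hι : ∀ (A : AbelianVariety ℂ) (g : A ⟶ A) (hg : IsIsogeny g), IotaPushforwardCompat (α A g hg)) :
    AtiyahClassPushforwardCompatPair P α := by
  intro A g hg E hE q
  letI := HasDerivedCategory.standard A.X.left.Modules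
  intro x
  exact mapShiftedHom_extMulAtiyahPower_pair_comp hg (P A g hg) (hδ A g hg) (α A g hg) (hjet A g hg) (hι A g hg) hE q x

end Assembly

end Summit.HodgeConjecture.HodgeConjecture.Ring2.SemiregularRepresentatives

end
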